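import Literature.Topology.FourManifolds.LargeKTrisectionClassificationProofs
import Literature.Topology.FourManifolds.TrisectionHandleDecompositionProofs
import HarnessLib

/-!
# Meier–Schirmer–Zupan, Thm. 1.2: the genus-`≤ 1` base — genus one numerology (PROVED) and the
# `S⁴` cases from Gay–Kirby's Lemma 13 and `Γ₄ = 0`

Topic `Literature/Topology/FourManifolds`, third proofs companion of
`LargeKTrisectionClassification.lean` (the named fact
`Literature.Topology.FourManifolds.msz_trisection_classification_gk`, MSZ Thm. 1.2), after
`LargeKTrisectionClassificationProofs.lean` (assembly and the whole printed induction on `g`,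
`msz_trisection_classification_gk_of_separatingReducible_of_genus_le_one`: the fact from the
separating splitting fact, separating reducibility for `g ≥ 2`, and the classification of
genus-`≤ 1` trisections `h0` / `h1`).  This file works on the base hypotheses `h0`, `h1`
("If `g = 1`, the statement follows from the classification of genus one trisections", MSZ §5;
"all six of the genus one trisections are standard", §3 p. 6).  Everything here is **proved**;
no definition and no named fact is introduced (D-0026); the fact itself is NOT discharged.

* `IsGKTrisection.eq_one_iff_ker_eq_of_genus_one`, **`IsGKTrisection.sum_ne_two_of_genus_one`
  (unconditional): no genus one trisection has `k₁ + k₂ + k₃ = 2`.**  With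
  `K_i = ker (π₁(F) → π₁(H_i))` at a base point of the central torus, `k_{i+2} = 1 ↔ K_i = K_{i+1}`
  — from the tree's proved van Kampen inputs (T1)–(T3) of `TrisectionFunctorGKInputs.lean`
  (`π₁(F) ⧸ K_i ≅ π₁(H_i) ≅ F₁`, `π₁(F) ⧸ ⟪K_i ∪ K_{i+1}⟫ ≅ π₁(∂X_{i+2}) ≅ F_{k(i+2)}`),
  `k ≤ g` (`IsGKTrisection.le_genus`) and the Hopfian property of `F₁`
  (`isFreeOfRank_pair_eq_one_iff`) — and equality of kernels is transitive.  Classically: the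
  meridians of a genus one splitting of `S¹ × S²` coincide, those of `S³` meet once (MSZ §3,
  p. 6); so the genus one types are `(1; 0, 0, 0)`, `(1; 1, 1, 1)` and `k₁ + k₂ + k₃ = 1`.
* `nonempty_diffeomorph_sphere_four_of_ncard_criticalSet_eq_two_of_cerf` — a closed `4`-manifold
  with a Morse function with exactly two critical points is `S⁴`, GIVEN `cerf_twistedSphere_four`
  (Reeb–Milnor twisted sphere, proved in `MorseTwoCriticalPoints.lean`, then Cerf).
* `IsGKTrisection.nonempty_diffeomorph_sphere_four_of_genus_zero_of_facts`,
  `IsGKTrisection.nonempty_diffeomorph_sphere_four_of_genus_one_of_facts` — **genus zero, and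
  genus one with `k₁ + k₂ + k₃ = 1`, give `S⁴`**, GIVEN Gay–Kirby's Lemma 13
  (`gkTrisection_exists_isMorse_isSelfIndexing`, named fact: `(1, k 0, g - k 1, k 2, 1)` handles)
  and `cerf_twistedSphere_four` (named fact): after relabelling the sectors the handle count is
  `(1, 0, 0, 0, 1)`.
* `msz_genus_one_of_facts` — the hypothesis `h1` of `msz_base_of_genus_le_one` from those two
  named facts and the two balanced genus one recognitions `(1; 0, 0, 0) ↦ ℂP²` (unoriented),
  `(1; 1, 1, 1) ↦ S¹ × S³` (MSZ §3 p. 6 — hypotheses, not in the tree).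
* `msz_trisection_classification_gk_of_facts` — **MSZ Thm. 1.2 from**: the separating
  splitting fact `Trisection.isConnectedSum_of_reducing_separating`, Gay–Kirby's Lemma 13,
  Cerf's `Γ₄ = 0` (three named facts of the tree, unproved), separating reducibility of
  `(g; ≥ g − 1, ·, ·)`-trisections for `g ≥ 2` (MSZ §5 via Thm. 5.1, Waldhausen, Lemma 4.4 —
  hypothesis), and the two balanced genus one recognitions (hypotheses).

So, relative to `…_of_separatingReducible_of_genus_le_one`, the genus zero base and four of the
six genus one trisections no longer enter as hypotheses of their own: they are reduced to named
facts of the tree, and the impossible genus one types are excluded outright.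

## References

* J. Meier, T. Schirmer, A. Zupan, *Classification of trisections and the Generalized Property R
  Conjecture*, Proc. AMS 144 (2016) 4983–4997 (arXiv:1507.06561): Thm. 1.2 and its proof (§5);
  §3, p. 6 (the six genus one trisections). [MeierSchirmerZupan2016]
* D. Gay, R. Kirby, *Trisecting 4-manifolds*, Geom. Topol. 20 (2016) 3097–3132: Lemma 13, §2.
  [GayKirby2016]
* A. Abrams, D. Gay, R. Kirby, *Group trisections and smooth 4-manifolds*, Geom. Topol. 22
  (2018), p. 1540. [AbramsGayKirby2018]
* J. Milnor, *Morse theory*, Ann. of Math. Studies 51 (1963), Thm. 4.1 and Remark (p. 25).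
  [Milnor1963]
* J. Cerf, *Sur les difféomorphismes de la sphère de dimension trois (Γ₄ = 0)*, LNM 53 (1968),
  Ch. I §1, Corollaire 1. [CerfDiffeoSphere1968]
* R. Lyndon, P. Schupp, *Combinatorial Group Theory* (2001), Ch. I Prop. 3.5 (free groups of
  finite rank are Hopfian). [LyndonSchupp2001]
-/

noncomputable section

open scoped Manifold ContDiff Topology
open Set Function

namespace Literature.Topology.FourManifolds

open Literature.AlgebraicTopology Literature.AlgebraicTopology.FundamentalGroup
  Literature.AlgebraicTopology.FundamentalGroup.VanKampen

universe u

/-! ### Algebra: Hopfian bookkeeping (local copies in the generality needed here) -/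

section Algebra

variable {G : Type*} [Group G]

/-- A surjection between two groups free of the same finite rank is injective (free groups of
finite rank are Hopfian; Mal'cev's residual-finiteness argument, in the tree
`injective_of_surjective_of_sameFiniteQuotients`). [cite: LyndonSchupp2001, Ch. I Prop. 3.5] -/
theorem IsFreeOfRank.injective_of_surjective_of_isFreeOfRank' {H : Type*} [Group H] {n : ℕ}
    (hH : IsFreeOfRank H n) (hG : IsFreeOfRank G n) (ψ : H →* G) (hψ : Surjective ψ) :
    Injective ψ := by
  obtain ⟨eH⟩ := hH
  obtain ⟨eG⟩ := hG
  have h : Injective (ψ.comp eH.toMonoidHom) := by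
    refine injective_of_surjective_of_sameFiniteQuotients _ (hψ.comp eH.surjective)
      fun Q _ _ => ⟨?_, ?_⟩
    · rintro ⟨f, hf⟩
      exact ⟨f.comp eG.toMonoidHom, hf.comp eG.surjective⟩
    · rintro ⟨f, hf⟩
      exact ⟨f.comp eG.symm.toMonoidHom, hf.comp eG.symm.surjective⟩
  intro a b hab
  obtain ⟨a, rfl⟩ := eH.surjective a
  obtain ⟨b, rfl⟩ := eH.surjective b
  exact congrArg eH (h hab)

/-- Nested normal subgroups `N ≤ K` whose quotients are free of the same finite rank are equal
(the projection `G ⧸ N ↠ G ⧸ K` is injective by the Hopfian property).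
[cite: LyndonSchupp2001, Ch. I Prop. 3.5] -/
theorem Subgroup.eq_of_le_of_isFreeOfRank_quotient' {N K : Subgroup G} [N.Normal] [K.Normal]
    (hNK : N ≤ K) {n : ℕ} (hN : IsFreeOfRank (G ⧸ N) n) (hK : IsFreeOfRank (G ⧸ K) n) :
    K = N := by
  refine le_antisymm (fun x hx => ?_) hNK
  have hinj := hN.injective_of_surjective_of_isFreeOfRank' hK
    (QuotientGroup.map N K (MonoidHom.id G) hNK)
    (fun y => by
      obtain ⟨s, rfl⟩ := QuotientGroup.mk_surjective y
      exact ⟨QuotientGroup.mk s, rfl⟩)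
  have h1 : QuotientGroup.map N K (MonoidHom.id G) hNK (QuotientGroup.mk x) = 1 := by
    rw [QuotientGroup.map_mk, MonoidHom.id_apply, QuotientGroup.eq_one_iff]
    exact hx
  have h2 : (QuotientGroup.mk x : G ⧸ N) = 1 := hinj (h1.trans (map_one _).symm)
  exact (QuotientGroup.eq_one_iff x).1 h2

/-- **The rank-one dichotomy.**  Let `K, K'` be normal subgroups of `G` with `G ⧸ K` and
`G ⧸ K'` free of rank `1`, and suppose `G ⧸ ⟪K ∪ K'⟫` is free of rank `r ≤ 1`.  Then `r = 1`
iff `K = K'`: if `r = 1`, both `K` and `K'` equal `⟪K ∪ K'⟫` by the Hopfian property; if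
`K = K'`, then `⟪K ∪ K'⟫ = K` and `G ⧸ K ≅ F₁` is not trivial, so `r ≠ 0`. [folklore] -/
theorem isFreeOfRank_pair_eq_one_iff {K K' : Subgroup G} [K.Normal] [K'.Normal]
    (hK : IsFreeOfRank (G ⧸ K) 1) (hK' : IsFreeOfRank (G ⧸ K') 1) {r : ℕ} (hr : r ≤ 1)
    (hpair : IsFreeOfRank (G ⧸ Subgroup.normalClosure ((K : Set G) ∪ K')) r) :
    r = 1 ↔ K = K' := by
  have hKle : K ≤ Subgroup.normalClosure ((K : Set G) ∪ K') :=
    fun x hx => Subgroup.subset_normalClosure (Or.inl hx)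
  have hK'le : K' ≤ Subgroup.normalClosure ((K : Set G) ∪ K') :=
    fun x hx => Subgroup.subset_normalClosure (Or.inr hx)
  constructor
  · rintro rfl
    have h1 := Subgroup.eq_of_le_of_isFreeOfRank_quotient' hKle hK hpair
    have h2 := Subgroup.eq_of_le_of_isFreeOfRank_quotient' hK'le hK' hpair
    exact h1.symm.trans h2
  · rintro rfl
    by_contra hr1
    obtain rfl : r = 0 := by omega
    have hN : Subgroup.normalClosure ((K : Set G) ∪ K) = K := by
      rw [Set.union_self]; exact Subgroup.normalClosure_eq_self K
    obtain ⟨e0⟩ := hpair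
    obtain ⟨e1⟩ := hK
    haveI : Subsingleton (G ⧸ Subgroup.normalClosure ((K : Set G) ∪ K)) :=
      e0.symm.toEquiv.subsingleton
    haveI : Subsingleton (G ⧸ K) :=
      (QuotientGroup.quotientMulEquivOfEq hN).symm.toEquiv.subsingleton
    exact FreeGroup.of_ne_one (0 : Fin 1) (e1.injective (Subsingleton.elim _ _))

end Algebra

/-! ### Genus one: `k₁ + k₂ + k₃ ≠ 2` -/

section GenusOne

variable {X : Type u} [TopologicalSpace X] [T2Space X] [SecondCountableTopology X]
  [ChartedSpace (EuclideanSpace ℝ (Fin 4)) X] {k : Fin 3 → ℕ} {S : Fin 3 → Set X}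

/-- **Genus one: `k_{i+2} = 1` iff the two handlebodies `H_i`, `H_{i+1}` of `∂X_{i+2}` have the
same kernel in `π₁(F)`.**  For a `(1; k 0, k 1, k 2)`-trisection and a base point `x` of the
central surface `F`, let `K_i = ker (π₁(F, x) → π₁(H_i, x))`.  Then `k (i + 2) = 1 ↔ K_i = K_{i+1}`:
`π₁(F) ⧸ K_i ≅ π₁(H_i) ≅ F₁` ((T1)), `π₁(F) ⧸ ⟪K_i ∪ K_{i+1}⟫ ≅ π₁(∂X_{i+2}) ≅ F_{k(i+2)}` ((T2),
(T3): `IsGKTrisection.isFreeOfRank_quotient_pair`), `k (i + 2) ≤ 1` (`IsGKTrisection.le_genus`),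
and the rank-one dichotomy `isFreeOfRank_pair_eq_one_iff`.  (Classically: a genus one Heegaard
splitting of `∂X ≅ S¹ × S²` has both meridians equal, one of `S³` has meridians meeting once;
Meier–Schirmer–Zupan 2016, §3, p. 6, the six genus one trisections.)
[cite: MeierSchirmerZupan2016, §3 (p. 6, genus one trisections)]
[cite: AbramsGayKirby2018, p. 1540 (π₁(H_ij) ≅ F_g, π₁(∂X_i) ≅ F_k)] -/
theorem IsGKTrisection.eq_one_iff_ker_eq_of_genus_one (h : IsGKTrisection X 1 k S) {x : X}
    (hx : x ∈ ⋂ l, S l) (i : Fin 3) :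
    k (i + 2) = 1 ↔
      (inclHomOfSubset (iInter_subset_inter S i) x hx (iInter_subset_inter S i hx)).ker =
        (inclHomOfSubset (iInter_subset_inter S (i + 1)) x hx
          (iInter_subset_inter S (i + 1) hx)).ker := by
  have hq : ∀ j : Fin 3, IsFreeOfRank (FundamentalGroup ↥(⋂ l, S l) ⟨x, hx⟩ ⧸
      (inclHomOfSubset (iInter_subset_inter S j) x hx (iInter_subset_inter S j hx)).ker) 1 :=
    fun j => IsFreeOfRank.quotient_of_ker_eq _ (h.surjective_inclHomOfSubset_handlebody j hx) rfl
      (h.isFreeOfRank_fundamentalGroup_handlebody j hx)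
  exact isFreeOfRank_pair_eq_one_iff (hq i) (hq (i + 1)) (h.le_genus (i + 2))
    (h.isFreeOfRank_quotient_pair i hx)

/-- **No genus one trisection has `k₁ + k₂ + k₃ = 2`.**  For a `(1; k 0, k 1, k 2)`-trisection of
a `4`-manifold (in the tree's sense `IsGKTrisection`), `k 0 + k 1 + k 2 ≠ 2`: with
`K_i = ker (π₁ F → π₁ H_i)` at a base point of the central surface, `k (i + 2) = 1 ↔ K_i = K_{i+1}`
(`IsGKTrisection.eq_one_iff_ker_eq_of_genus_one`), and two of the three equalities `K₀ = K₁`,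
`K₁ = K₂`, `K₂ = K₀` imply the third.  Hence the genus one types are `(1; 0, 0, 0)`, `(1; 1, 1, 1)`
and the three with `k 0 + k 1 + k 2 = 1` — the parameters of the six genus one trisections
(Meier–Schirmer–Zupan 2016, §3, p. 6: `ℂP²`, `ℂP²‾`, `S¹ × S³` and the three stabilisations of
the genus zero trisection of `S⁴`). [cite: MeierSchirmerZupan2016, §3 (p. 6, genus one trisections)] -/
theorem IsGKTrisection.sum_ne_two_of_genus_one (h : IsGKTrisection X 1 k S) :
    k 0 + k 1 + k 2 ≠ 2 := by
  obtain ⟨x, hx⟩ := h.nonempty_iInter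
  have e0 := h.eq_one_iff_ker_eq_of_genus_one hx 0
  have e1 := h.eq_one_iff_ker_eq_of_genus_one hx 1
  have e2 := h.eq_one_iff_ker_eq_of_genus_one hx 2
  simp only [show (0 : Fin 3) + 2 = 2 from rfl, show (1 : Fin 3) + 2 = 0 from rfl,
    show (2 : Fin 3) + 2 = 1 from rfl] at e0 e1 e2
  have h0 := h.le_genus 0
  have h1 := h.le_genus 1
  have h2 := h.le_genus 2
  intro hsum
  rcases (by omega : (k 0 = 1 ∧ k 1 = 1 ∧ k 2 = 0) ∨ (k 0 = 1 ∧ k 1 = 0 ∧ k 2 = 1) ∨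
      (k 0 = 0 ∧ k 1 = 1 ∧ k 2 = 1)) with ⟨a, b, c⟩ | ⟨a, b, c⟩ | ⟨a, b, c⟩
  · have := e0.2 ((e1.1 a).trans (e2.1 b)).symm
    omega
  · have := e2.2 ((e0.1 c).trans (e1.1 a)).symm
    omega
  · have := e1.2 ((e2.1 b).trans (e0.1 c)).symm
    omega

end GenusOne

/-! ### The `S⁴` cases from the handle decomposition (Gay–Kirby Lemma 13) and `Γ₄ = 0` -/

section Sphere

/-- Counting critical points by index on a `4`-manifold: a finite critical set is the disjoint
union of the critical sets of index `≤ 4`. [cite: Milnor1963, §2–§3 (index of a nondegenerate critical point)] -/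
theorem ncard_criticalSet_eq_sum_range_five {X : Type*} [TopologicalSpace X]
    [ChartedSpace (EuclideanSpace ℝ (Fin 4)) X] (f : X → ℝ)
    (hfin : (criticalSet (𝓡 4) f).Finite) :
    (criticalSet (𝓡 4) f).ncard = ∑ i ∈ Finset.range 5, (criticalSetOfIndex (𝓡 4) f i).ncard := by
  classical
  rw [Set.ncard_eq_toFinset_card _ hfin,
    Finset.card_eq_sum_card_fiberwise (f := morseIndex (𝓡 4) f) (t := Finset.range 5)
      fun x _ => Finset.mem_range.2 (Nat.lt_succ_of_le
        ((morseIndex_le_finrank (𝓡 4) f x).trans (finrank_euclideanSpace_fin (𝕜 := ℝ) (n := 4)).le))]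
  refine Finset.sum_congr rfl fun i _ => ?_
  rw [← Set.ncard_coe_finset]
  congr 1
  ext x
  simp [mem_criticalSetOfIndex]

/-- **A closed smooth `4`-manifold with a Morse function having exactly two critical points is
`S⁴`, given Cerf's `Γ₄ = 0`**: it is a twisted sphere `D⁴ ∪_φ D⁴` (Reeb–Milnor,
`IsMorse.exists_isTwistedSphere_of_ncard_criticalSet_eq_two`, proved in the tree), and every
twisted `4`-sphere is `S⁴` under `cerf_twistedSphere_four`
(`nonempty_diffeomorph_sphere_four_of_isTwistedSphere_of_cerf`).
[cite: Milnor1963, Thm. 4.1 and Remark (p. 25)] [cite: CerfDiffeoSphere1968, Ch. I §1, Corollaire 1 (Γ₄ = 0)] -/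
theorem nonempty_diffeomorph_sphere_four_of_ncard_criticalSet_eq_two_of_cerf
    (hC : cerf_twistedSphere_four) {X : Type} [TopologicalSpace X] [T2Space X]
    [SecondCountableTopology X] [CompactSpace X] [ChartedSpace (EuclideanSpace ℝ (Fin 4)) X]
    [IsManifold (𝓡 4) ∞ X] {f : X → ℝ} (hf : IsMorse (𝓡 4) f)
    (h2 : (criticalSet (𝓡 4) f).ncard = 2) :
    Nonempty (X ≃ₘ⟮𝓡 4, 𝓡 4⟯ Metric.sphere (0 : EuclideanSpace ℝ (Fin 5)) 1) := by
  obtain ⟨φ, hφ⟩ :=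
    IsMorse.exists_isTwistedSphere_of_ncard_criticalSet_eq_two (k := 3) (M := X) (by norm_num) hf h2
  exact nonempty_diffeomorph_sphere_four_of_isTwistedSphere_of_cerf hC hφ

variable {X : Type} [TopologicalSpace X] [T2Space X] [SecondCountableTopology X]
  [ChartedSpace (EuclideanSpace ℝ (Fin 4)) X] [IsManifold (𝓡 4) ∞ X] [CompactSpace X]
  [ConnectedSpace X] {k : Fin 3 → ℕ} {S : Fin 3 → Set X}

/-- **A closed connected oriented `4`-manifold with a genus zero trisection is `S⁴`, from
Gay–Kirby's Lemma 13 and `Γ₄ = 0`.**  GIVEN the handle decomposition induced by a trisection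
(`gkTrisection_exists_isMorse_isSelfIndexing`: a self-indexing Morse function with
`(1, k 0, g - k 1, k 2, 1)` critical points) and Cerf's theorem (`cerf_twistedSphere_four`), a
`(0; k)`-trisected `X` — where `k = (0, 0, 0)` by `IsGKTrisection.le_genus` — carries a Morse
function with exactly two critical points, hence is a twisted sphere and so `S⁴`
(`nonempty_diffeomorph_sphere_four_of_ncard_criticalSet_eq_two_of_cerf`).  (Gay–Kirby 2016, §2:
the `(0; 0)`-trisection is that of `S⁴`; Meier–Schirmer–Zupan 2016, §3.)
[cite: GayKirby2016, Lemma 13 and §2 (genus zero)] [cite: Milnor1963, Thm. 4.1 and Remark (p. 25)]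
[cite: CerfDiffeoSphere1968, Ch. I §1, Corollaire 1 (Γ₄ = 0)] -/
theorem IsGKTrisection.nonempty_diffeomorph_sphere_four_of_genus_zero_of_facts
    (hGK : gkTrisection_exists_isMorse_isSelfIndexing) (hC : cerf_twistedSphere_four)
    (o : SmoothOrientation (𝓡 4) X) (hT : IsGKTrisection X 0 k S) :
    Nonempty (X ≃ₘ⟮𝓡 4, 𝓡 4⟯ Metric.sphere (0 : EuclideanSpace ℝ (Fin 5)) 1) := by
  obtain ⟨f, hf, -, h0, h1, h2, h3, h4⟩ := hGK X o 0 k S hT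
  have hk0 := hT.le_genus 0
  have hk2 := hT.le_genus 2
  refine nonempty_diffeomorph_sphere_four_of_ncard_criticalSet_eq_two_of_cerf hC hf ?_
  rw [ncard_criticalSet_eq_sum_range_five f (IsMorse.finite_criticalSet_holds hf)]
  simp only [Finset.sum_range_succ, Finset.sum_range_zero, h0, h1, h2, h3, h4]
  omega

/-- **A closed connected oriented `4`-manifold with a genus one trisection of type `(1; k)`,
`k 0 + k 1 + k 2 = 1`, is `S⁴`, from Gay–Kirby's Lemma 13 and `Γ₄ = 0`.**  Relabel the sectors
(`IsGKTrisection.comp_perm`) so that the sector with `kᵢ = 1` is the middle one; the induced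
handle decomposition (`gkTrisection_exists_isMorse_isSelfIndexing.comp_perm`) has
`(1, 0, 1 - 1, 0, 1)` handles, i.e. a Morse function with exactly two critical points, and
`X ≅ S⁴` as in the genus zero case.  (Meier–Schirmer–Zupan 2016, §3, p. 6: "The three unbalanced
genus one trisections of `S⁴` […] correspond to the three stabilization operations".)
[cite: MeierSchirmerZupan2016, §3 (p. 6, genus one trisections)] [cite: GayKirby2016, Lemma 13]
[cite: CerfDiffeoSphere1968, Ch. I §1, Corollaire 1 (Γ₄ = 0)] -/
theorem IsGKTrisection.nonempty_diffeomorph_sphere_four_of_genus_one_of_facts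
    (hGK : gkTrisection_exists_isMorse_isSelfIndexing) (hC : cerf_twistedSphere_four)
    (o : SmoothOrientation (𝓡 4) X) (hT : IsGKTrisection X 1 k S) (hk : k 0 + k 1 + k 2 = 1) :
    Nonempty (X ≃ₘ⟮𝓡 4, 𝓡 4⟯ Metric.sphere (0 : EuclideanSpace ℝ (Fin 5)) 1) := by
  -- a relabelling `σ` with `k (σ 1) = 1`, `k (σ 0) = k (σ 2) = 0`
  obtain ⟨σ, h1σ, h0σ, h2σ⟩ :
      ∃ σ : Equiv.Perm (Fin 3), k (σ 1) = 1 ∧ k (σ 0) = 0 ∧ k (σ 2) = 0 := by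
    rcases (by omega : k 0 = 1 ∨ k 1 = 1 ∨ k 2 = 1) with h | h | h
    · refine ⟨Equiv.swap 0 1, ?_, ?_, ?_⟩
      · simpa using h
      · simp only [Equiv.swap_apply_left]; omega
      · rw [Equiv.swap_apply_of_ne_of_ne (by decide) (by decide)]; omega
    · exact ⟨Equiv.refl _, by simpa using h, by simp only [Equiv.refl_apply]; omega,
        by simp only [Equiv.refl_apply]; omega⟩
    · refine ⟨Equiv.swap 1 2, ?_, ?_, ?_⟩
      · simpa using h
      · rw [Equiv.swap_apply_of_ne_of_ne (by decide) (by decide)]; omega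
      · simp only [Equiv.swap_apply_right]; omega
  obtain ⟨f, hf, -, c0, c1, c2, c3, c4⟩ := hGK.comp_perm o hT σ
  rw [h0σ] at c1
  rw [h1σ] at c2
  rw [h2σ] at c3
  refine nonempty_diffeomorph_sphere_four_of_ncard_criticalSet_eq_two_of_cerf hC hf ?_
  rw [ncard_criticalSet_eq_sum_range_five f (IsMorse.finite_criticalSet_holds hf)]
  simp only [Finset.sum_range_succ, Finset.sum_range_zero, c0, c1, c2, c3, c4]

end Sphere

/-! ### MSZ Thm. 1.2 from the splitting fact, reducibility, Lemma 13, `Γ₄ = 0` and the two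
balanced genus one recognitions -/

/-- **The genus one classification hypothesis `h1` of `msz_base_of_genus_le_one`, from
Gay–Kirby's Lemma 13, `Γ₄ = 0` and the two balanced genus one recognitions.**  GIVEN
`gkTrisection_exists_isMorse_isSelfIndexing`, `cerf_twistedSphere_four`, and the recognition of
the underlying manifold of a `(1; 0, 0, 0)`-trisection as `ℂP²` (unoriented, so covering `ℂP²‾`)
and of a `(1; 1, 1, 1)`-trisection as `S¹ × S³` (Meier–Schirmer–Zupan 2016, §3, p. 6: "The three
possibilities in the balanced case […] correspond to `ℂP²`, `ℂP²‾`, and `S¹ × S³`" — hypotheses,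
not in the tree), every genus one trisection falls under one of the three alternatives of `h1`:
`k 0 + k 1 + k 2 ∈ {0, 1, 3}` by `IsGKTrisection.le_genus` and
`IsGKTrisection.sum_ne_two_of_genus_one` (proved), and the case `k 0 + k 1 + k 2 = 1` is `S⁴` by
`IsGKTrisection.nonempty_diffeomorph_sphere_four_of_genus_one_of_facts`.
[cite: MeierSchirmerZupan2016, §3 (p. 6, the six genus one trisections)] [cite: GayKirby2016, Lemma 13] -/
theorem msz_genus_one_of_facts
    (hGK : gkTrisection_exists_isMorse_isSelfIndexing) (hC : cerf_twistedSphere_four)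
    (hCP2 : ∀ (X : Type) [TopologicalSpace X] [T2Space X] [SecondCountableTopology X]
      [ChartedSpace (EuclideanSpace ℝ (Fin 4)) X] [IsManifold (𝓡 4) ∞ X] [CompactSpace X]
      [ConnectedSpace X] (_ : SmoothOrientation (𝓡 4) X) (k : Fin 3 → ℕ) (S : Fin 3 → Set X),
      IsGKTrisection X 1 k S → (∀ i, k i = 0) →
        Nonempty (X ≃ₘ⟮𝓡 4, 𝓡 4⟯ ComplexProjectivePlane))
    (hS1S3 : ∀ (X : Type) [TopologicalSpace X] [T2Space X] [SecondCountableTopology X]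
      [ChartedSpace (EuclideanSpace ℝ (Fin 4)) X] [IsManifold (𝓡 4) ∞ X] [CompactSpace X]
      [ConnectedSpace X] (_ : SmoothOrientation (𝓡 4) X) (k : Fin 3 → ℕ) (S : Fin 3 → Set X),
      IsGKTrisection X 1 k S → (∀ i, k i = 1) →
        Nonempty (X ≃ₘ⟮𝓡 4, (𝓡 1).prod (𝓡 3)⟯
          (Circle × (Metric.sphere (0 : EuclideanSpace ℝ (Fin 4)) 1))))
    (X : Type) [TopologicalSpace X] [T2Space X] [SecondCountableTopology X]
    [ChartedSpace (EuclideanSpace ℝ (Fin 4)) X] [IsManifold (𝓡 4) ∞ X] [CompactSpace X]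
    [ConnectedSpace X] (o : SmoothOrientation (𝓡 4) X) (k : Fin 3 → ℕ) (S : Fin 3 → Set X)
    (hT : IsGKTrisection X 1 k S) :
    (k 0 + k 1 + k 2 = 1 ∧
        Nonempty (X ≃ₘ⟮𝓡 4, 𝓡 4⟯ Metric.sphere (0 : EuclideanSpace ℝ (Fin 5)) 1)) ∨
      ((∀ i, k i = 0) ∧ Nonempty (X ≃ₘ⟮𝓡 4, 𝓡 4⟯ ComplexProjectivePlane)) ∨
      ((∀ i, k i = 1) ∧ Nonempty (X ≃ₘ⟮𝓡 4, (𝓡 1).prod (𝓡 3)⟯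
        (Circle × (Metric.sphere (0 : EuclideanSpace ℝ (Fin 4)) 1)))) := by
  have h0 := hT.le_genus 0
  have h1 := hT.le_genus 1
  have h2 := hT.le_genus 2
  have hne := hT.sum_ne_two_of_genus_one
  rcases (by omega : k 0 + k 1 + k 2 = 1 ∨ (k 0 = 0 ∧ k 1 = 0 ∧ k 2 = 0) ∨
      (k 0 = 1 ∧ k 1 = 1 ∧ k 2 = 1)) with h | ⟨a, b, c⟩ | ⟨a, b, c⟩
  · exact Or.inl ⟨h, hT.nonempty_diffeomorph_sphere_four_of_genus_one_of_facts hGK hC o h⟩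
  · have hk : ∀ i, k i = 0 := fun i => by fin_cases i <;> assumption
    exact Or.inr (Or.inl ⟨hk, hCP2 X o k S hT hk⟩)
  · have hk : ∀ i, k i = 1 := fun i => by fin_cases i <;> assumption
    exact Or.inr (Or.inr ⟨hk, hS1S3 X o k S hT hk⟩)

/-- **Meier–Schirmer–Zupan's Thm. 1.2 from named facts of the tree and the two remaining printed
inputs.**  The fact `msz_trisection_classification_gk` follows (in every universe) from:
the separating splitting fact `Trisection.isConnectedSum_of_reducing_separating` (MSZ Prop. 3.5 /
proof of Prop. 3.9; named fact); a separating reducing curve for every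
`(g; ≥ g − 1, ·, ·)`-trisection of genus `g ≥ 2` (MSZ §5: Thm. 5.1, Waldhausen, Lemma 4.4 —
hypothesis, not in the tree); Gay–Kirby's Lemma 13 `gkTrisection_exists_isMorse_isSelfIndexing`
and Cerf's `cerf_twistedSphere_four` (named facts), which settle the genus zero case and the
three unbalanced genus one cases (`S⁴`); and the recognition of the two balanced genus one
types `(1; 0, 0, 0) ↦ ℂP²` (unoriented), `(1; 1, 1, 1) ↦ S¹ × S³` (MSZ §3, p. 6 — hypotheses, not
in the tree).  The exclusion of `k 0 + k 1 + k 2 = 2` in genus one is proved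
(`IsGKTrisection.sum_ne_two_of_genus_one`); assembly by
`msz_trisection_classification_gk_of_separatingReducible_of_genus_le_one`.
[cite: MeierSchirmerZupan2016, Thm. 1.2 and its proof (§5); §3 (p. 6)]
[cite: GayKirby2016, Lemma 13 and §2] [cite: CerfDiffeoSphere1968, Ch. I §1, Corollaire 1 (Γ₄ = 0)] -/
theorem msz_trisection_classification_gk_of_facts
    (hsep : Trisection.isConnectedSum_of_reducing_separating.{0})
    (hred : ∀ (X : Type) [TopologicalSpace X] [T2Space X] [SecondCountableTopology X]
      [ChartedSpace (EuclideanSpace ℝ (Fin 4)) X] [IsManifold (𝓡 4) ∞ X] [CompactSpace X]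
      [ConnectedSpace X] (_ : SmoothOrientation (𝓡 4) X) (g : ℕ) (k : Fin 3 → ℕ)
      (S : Fin 3 → Set X), IsGKTrisection X g k S → 2 ≤ g → g ≤ k 0 + 1 →
        ∃ δ : Set X, Trisection.IsCurve S δ ∧
          ¬ (∃ e : Metric.closedBall (0 : EuclideanSpace ℝ (Fin 2)) 1 → X,
              Manifold.IsSmoothEmbedding (𝓡∂ 2) (𝓡 4) ∞ e ∧
              range e ⊆ Trisection.centralSurfaceSet S ∧
              e '' (𝓡∂ 2).boundary (Metric.closedBall (0 : EuclideanSpace ℝ (Fin 2)) 1) = δ) ∧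
          (∀ q : Fin 3, Trisection.BoundsDisc S (Trisection.spineHandlebody S q) δ) ∧
          ¬ Trisection.IsNonSeparating S δ)
    (hGK : gkTrisection_exists_isMorse_isSelfIndexing) (hC : cerf_twistedSphere_four)
    (hCP2 : ∀ (X : Type) [TopologicalSpace X] [T2Space X] [SecondCountableTopology X]
      [ChartedSpace (EuclideanSpace ℝ (Fin 4)) X] [IsManifold (𝓡 4) ∞ X] [CompactSpace X]
      [ConnectedSpace X] (_ : SmoothOrientation (𝓡 4) X) (k : Fin 3 → ℕ) (S : Fin 3 → Set X),
      IsGKTrisection X 1 k S → (∀ i, k i = 0) →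
        Nonempty (X ≃ₘ⟮𝓡 4, 𝓡 4⟯ ComplexProjectivePlane))
    (hS1S3 : ∀ (X : Type) [TopologicalSpace X] [T2Space X] [SecondCountableTopology X]
      [ChartedSpace (EuclideanSpace ℝ (Fin 4)) X] [IsManifold (𝓡 4) ∞ X] [CompactSpace X]
      [ConnectedSpace X] (_ : SmoothOrientation (𝓡 4) X) (k : Fin 3 → ℕ) (S : Fin 3 → Set X),
      IsGKTrisection X 1 k S → (∀ i, k i = 1) →
        Nonempty (X ≃ₘ⟮𝓡 4, (𝓡 1).prod (𝓡 3)⟯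
          (Circle × (Metric.sphere (0 : EuclideanSpace ℝ (Fin 4)) 1)))) :
    msz_trisection_classification_gk.{u} :=
  msz_trisection_classification_gk_of_separatingReducible_of_genus_le_one hsep hred
    (fun _ _ _ _ _ _ _ _ o _ _ hT =>
      hT.nonempty_diffeomorph_sphere_four_of_genus_zero_of_facts hGK hC o)
    (msz_genus_one_of_facts hGK hC hCP2 hS1S3)

end Literature.Topology.FourManifolds

end
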